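import Mathlib.Data.Sign.Basic
import Literature.NumberTheory.LFunctions.HeckeThetaGamma
import HarnessLib

/-!
# Sign pieces of Hecke's weighted theta function and their unfolding over the units

Topic `Literature/NumberTheory/LFunctions`; namespace `Literature.NumberTheory.LFunctions.NumberField`
(continuing `HeckeThetaGamma.lean`).  Fourth step of the continuation of the partial zeta functions of
narrow ray classes (Neukirch, *Algebraic Number Theory*, VII §8 (8.2)–(8.3), for cosets and sign
weights): the unfolding `∫_F Σ_{a} = Σ_{a ∈ ℜ} ∫_S` of the proof of (8.3) ("`(𝔎 ∩ 𝒪)/𝒪^*`, `ℜ` a system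
of representatives"), here for the coset `a₀ + 𝔞` modulo the group `V = ⟨u_i^N⟩` of `N`-th powers of
the fundamental units, which stabilises the coset under the hypothesis `(u_i^N - 1) a₀ ∈ 𝔞`.

To stay within nonnegative series (Tonelli) we split `Θ̃^p - Θ̃(∞)` according to the SIGN of
`N(x^p)`: for `ς = ±1`,

* `pieceTheta K p ς 𝔞 a₀ y = Σ_{x ∈ a₀+𝔞, x ≠ 0, sgn N(x^p) = ς} |N(x^p)| N(y^{p/2}) e^{-π⟨xy,x⟩} ≥ 0`, with
  `Θ̃^p_{𝔞,a₀}(y) - Θ̃(∞) = pieceTheta(+1) - pieceTheta(-1)` (`heckeThetaW_sub_const_eq_pieceTheta_sub`);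
* `pieceReps K p ς 𝔞 a₀ N` — the elements of that sign piece whose cone exponent lies in the box
  `[0,N)^{r-1}`: a system of representatives modulo `V` (`pieceEquiv`, for `N` even and
  `(u_i^N - 1)a₀ ∈ 𝔞`: then `V` stabilises the coset and, `N` being even, the signs);

and PROVE the unfolded Mellin transform of each piece at real `σ > 0`
(`lintegral_Ioi_rpow_mul_pieceF`):

  `∫_{t>0} t^{σ-1} ∫_{[0,1]^{r-1}} pieceTheta(y(Nc, t)) dc dt
      = Σ_{x ∈ pieceReps} N^{-(r-1)} 2^{-(r-1)} n (2^{-r₂} n R)⁻¹ A_p(σ) |N_{K/ℚ}(x)|^{-2σ}`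

(`ℝ≥0∞`-valued), by re-indexing along `pieceEquiv`, moving the unit `u_{Nq}` onto the coordinates
(`weightedThetaSummand_fundUnit_mul`), tiling `ℝ^{r-1}` by the translates of the unit cube
(`lintegral_eq_tsum_lintegral_unitCube_add_intCast` of `DedekindZetaMellinProofs.lean`), rescaling
`c ↦ Nc`, and the Gamma integral of `HeckeThetaGamma.lean`.

## References

* J. Neukirch, *Algebraic Number Theory*, Grundlehren 322, Springer 1999, Ch. VII §5 proof of (5.5),
  §8 (8.2)–(8.3) and Remark 1. [NeukirchANT1999]
-/

noncomputable section

open MeasureTheory Filter Set Submodule Complex NumberField NumberField.InfinitePlace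
  NumberField.mixedEmbedding NumberField.Units
open scoped Real Topology ENNReal NumberField nonZeroDivisors

namespace Literature.NumberTheory.LFunctions

namespace NumberField

variable {K : Type*} [Field K] [NumberField K]

open scoped Classical

open NumberField.mixedEmbedding NumberField.mixedEmbedding.fundamentalCone
  NumberField.Units.dirichletUnitTheorem

/-! ## Signs of `N(x^p)` and the sign pieces -/

omit [NumberField K] in
/-- `N(x^p) ≠ 0` for `x ≠ 0` (the real embeddings are injective). [folklore] -/
theorem realPow_ne_zero (p : Finset {w : InfinitePlace K // IsReal w}) {x : K} (hx : x ≠ 0) :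
    realPow K p x ≠ 0 :=
  Finset.prod_ne_zero_iff.mpr fun w _ ↦ by
    rw [mixedEmbedding_apply_isReal]; exact (map_ne_zero _).mpr hx

omit [NumberField K] in
/-- `N((ux)^p) = N(u^p) N(x^p)`. [folklore] -/
theorem realPow_mul (p : Finset {w : InfinitePlace K // IsReal w}) (u x : K) :
    realPow K p (u * x) = realPow K p u * realPow K p x := by
  rw [realPow, realPow, realPow, ← Finset.prod_mul_distrib]
  exact Finset.prod_congr rfl fun w _ ↦ by rw [map_mul, Prod.fst_mul, Pi.mul_apply]

omit [NumberField K] in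
/-- `N((u²)^p) > 0` for `u ≠ 0`… more precisely `N((u²)^p) = N(u^p)² ≥ 0`. [folklore] -/
theorem realPow_sq (p : Finset {w : InfinitePlace K // IsReal w}) (u : K) :
    realPow K p (u ^ 2) = realPow K p u ^ 2 := by
  rw [sq, sq, realPow_mul]

omit [NumberField K] in
/-- `sgn N((u² x)^p) = sgn N(x^p)` for `u ≠ 0` (`N((u²)^p) = N(u^p)² > 0`). [folklore] -/
theorem sign_realPow_sq_mul (p : Finset {w : InfinitePlace K // IsReal w}) {u : K} (hu : u ≠ 0) (x : K) :
    SignType.sign (realPow K p (u ^ 2 * x)) = SignType.sign (realPow K p x) := by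
  rw [realPow_mul, realPow_sq, sign_mul, sign_pos (sq_pos_of_ne_zero (realPow_ne_zero p hu)), one_mul]

variable (K)

/-- **`x` lies in the sign piece `ς`**: `x ≠ 0` and `sgn N(x^p) = ς` (`ς = ±1`). [folklore] -/
def SignPiece (p : Finset {w : InfinitePlace K // IsReal w}) (ς : SignType) (x : K) : Prop :=
  x ≠ 0 ∧ SignType.sign (realPow K p x) = ς

/-- **The sign piece `ς` of the normalised weighted theta series of the coset `a₀ + 𝔞`**:
`Σ_{a ∈ 𝔞, a+a₀ ≠ 0, sgn N((a+a₀)^p) = ς} |N((a+a₀)^p)| N(y^{p/2}) e^{-π⟨(a+a₀)y, a+a₀⟩}` — a series of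
nonnegative terms. [folklore] -/
def pieceTheta (p : Finset {w : InfinitePlace K // IsReal w}) (ς : SignType) (I : FractionalIdeal (𝓞 K)⁰ K)
    (a₀ : K) (y : InfinitePlace K → ℝ) : ℝ :=
  ∑' a : I, if SignPiece K p ς ((a : K) + a₀) then weightedThetaSummand K p y ((a : K) + a₀) else 0

variable {K}

/-- The terms of the sign pieces are nonnegative. [folklore] -/
theorem pieceTheta_term_nonneg (p : Finset {w : InfinitePlace K // IsReal w}) (ς : SignType)
    (y : InfinitePlace K → ℝ) (x : K) :
    0 ≤ (if SignPiece K p ς x then weightedThetaSummand K p y x else 0) := by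
  split_ifs
  · exact weightedThetaSummand_nonneg p y x
  · exact le_rfl

/-- The terms of the sign pieces are dominated by the terms of the absolute tail. [folklore] -/
theorem pieceTheta_term_le (p : Finset {w : InfinitePlace K // IsReal w}) (ς : SignType)
    (y : InfinitePlace K → ℝ) (x : K) :
    (if SignPiece K p ς x then weightedThetaSummand K p y x else 0) ≤
      (if x = 0 then 0 else weightedThetaSummand K p y x) := by
  by_cases h : SignPiece K p ς x
  · rw [if_pos h, if_neg h.1]
  · rw [if_neg h]
    split_ifs
    · exact le_rfl
    · exact weightedThetaSummand_nonneg p y x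

/-- Summability of the sign pieces for `y > 0`. [folklore] -/
theorem summable_pieceTheta (p : Finset {w : InfinitePlace K // IsReal w}) (ς : SignType)
    (I : FractionalIdeal (𝓞 K)⁰ K) (a₀ : K) {y : InfinitePlace K → ℝ} (hy : ∀ w, 0 < y w) :
    Summable fun a : I ↦
      if SignPiece K p ς ((a : K) + a₀) then weightedThetaSummand K p y ((a : K) + a₀) else 0 :=
  (summable_weightedThetaTail p I a₀ hy).of_nonneg_of_le (fun _ ↦ pieceTheta_term_nonneg p ς y _)
    fun _ ↦ pieceTheta_term_le p ς y _

/-- `0 ≤ pieceTheta`. [folklore] -/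
theorem pieceTheta_nonneg (p : Finset {w : InfinitePlace K // IsReal w}) (ς : SignType)
    (I : FractionalIdeal (𝓞 K)⁰ K) (a₀ : K) (y : InfinitePlace K → ℝ) : 0 ≤ pieceTheta K p ς I a₀ y :=
  tsum_nonneg fun _ ↦ pieceTheta_term_nonneg p ς y _

/-- `pieceTheta ≤ weightedThetaTail ≤ θ_{𝔞+(a₀)}(iy/2) - 1`. [folklore] -/
theorem pieceTheta_le_weightedThetaTail (p : Finset {w : InfinitePlace K // IsReal w}) (ς : SignType)
    (I : FractionalIdeal (𝓞 K)⁰ K) (a₀ : K) {y : InfinitePlace K → ℝ} (hy : ∀ w, 0 < y w) :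
    pieceTheta K p ς I a₀ y ≤ weightedThetaTail K p I a₀ y :=
  Summable.tsum_le_tsum (fun _ ↦ pieceTheta_term_le p ς y _) (summable_pieceTheta p ς I a₀ hy)
    (summable_weightedThetaTail p I a₀ hy)

/-- **Splitting `Θ̃ - Θ̃(∞)` by the sign of `N(x^p)`**:
`Θ̃^p_{𝔞,a₀}(y) - Θ̃(∞) = pieceTheta(+1) - pieceTheta(-1)` (for `x ≠ 0`,
`N(x^p) N(y^{p/2}) e^{-π⟨xy,x⟩} = sgn N(x^p) · |N(x^p)| N(y^{p/2}) e^{-π⟨xy,x⟩}` and `sgn N(x^p) = ±1`).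
[folklore] -/
theorem heckeThetaW_sub_const_eq_pieceTheta_sub (p : Finset {w : InfinitePlace K // IsReal w})
    (I : FractionalIdeal (𝓞 K)⁰ K) (a₀ : K) {y : InfinitePlace K → ℝ} (hy : ∀ w, 0 < y w) :
    heckeThetaW K p I a₀ y - heckeThetaConst K p I a₀ =
      ((pieceTheta K p 1 I a₀ y : ℝ) : ℂ) - ((pieceTheta K p (-1) I a₀ y : ℝ) : ℂ) := by
  -- termwise identity off the zero term
  have hterm : ∀ x : K, x ≠ 0 →
      ((realPow K p x * (∏ w ∈ p, Real.sqrt (y w.1)) * thetaSummand K y x : ℝ) : ℂ) =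
        (((if SignPiece K p 1 x then weightedThetaSummand K p y x else 0) : ℝ) : ℂ) -
        (((if SignPiece K p (-1) x then weightedThetaSummand K p y x else 0) : ℝ) : ℂ) := by
    intro x hx
    have hne := realPow_ne_zero p hx
    have habs := abs_realPow_mul_prod_sqrt_mul p y x
    rw [abs_mul, abs_mul, abs_of_nonneg (Finset.prod_nonneg fun w _ ↦ Real.sqrt_nonneg _),
      abs_of_pos (thetaSummand_pos y x)] at habs
    rcases lt_or_gt_of_ne hne with hneg | hpos
    · have h1 : ¬ SignPiece K p 1 x := fun h ↦ by
        have := h.2; rw [sign_neg hneg] at this; exact absurd this (by decide)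
      have h2 : SignPiece K p (-1) x := ⟨hx, sign_neg hneg⟩
      rw [if_neg h1, if_pos h2, ← habs, abs_of_neg hneg]
      push_cast; ring
    · have h1 : SignPiece K p 1 x := ⟨hx, sign_pos hpos⟩
      have h2 : ¬ SignPiece K p (-1) x := fun h ↦ by
        have := h.2; rw [sign_pos hpos] at this; exact absurd this (by decide)
      rw [if_pos h1, if_neg h2, ← habs, abs_of_pos hpos]
      push_cast; ring
  -- the zero term
  have hzero : ∀ x : K, x = 0 →
      (((if SignPiece K p 1 x then weightedThetaSummand K p y x else 0) : ℝ) : ℂ) -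
        (((if SignPiece K p (-1) x then weightedThetaSummand K p y x else 0) : ℝ) : ℂ) = 0 := by
    intro x hx
    rw [if_neg (fun h ↦ h.1 hx), if_neg (fun h ↦ h.1 hx), sub_self]
  -- summable families
  have hs1 := summable_pieceTheta p 1 I a₀ hy
  have hs2 := summable_pieceTheta p (-1) I a₀ hy
  have hsC1 : Summable fun a : I ↦ (((if SignPiece K p 1 ((a : K) + a₀) then
      weightedThetaSummand K p y ((a : K) + a₀) else 0) : ℝ) : ℂ) := (Complex.ofRealCLM.summable hs1)
  have hsC2 : Summable fun a : I ↦ (((if SignPiece K p (-1) ((a : K) + a₀) then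
      weightedThetaSummand K p y ((a : K) + a₀) else 0) : ℝ) : ℂ) := (Complex.ofRealCLM.summable hs2)
  rw [pieceTheta, pieceTheta, Complex.ofReal_tsum, Complex.ofReal_tsum, ← hsC1.tsum_sub hsC2]
  -- now compare with `Θ̃ - const` termwise, treating the zero term
  have hneg : ∀ {x : K}, x ∈ I → -x ∈ I := fun hx ↦
    FractionalIdeal.mem_coe.mp (Submodule.neg_mem _ (FractionalIdeal.mem_coe.mpr hx))
  by_cases ha₀ : a₀ ∈ I
  · let z : I := ⟨-a₀, hneg ha₀⟩
    have hz : (z : K) + a₀ = 0 := neg_add_cancel a₀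
    have hsum : Summable fun a : I ↦ ((realPow K p ((a : K) + a₀) * (∏ w ∈ p, Real.sqrt (y w.1)) *
        thetaSummand K y ((a : K) + a₀) : ℝ) : ℂ) := by
      refine ((hsC1.sub hsC2).add (summable_of_ne_finset_zero (s := {z}) (f := fun a : I ↦
        if a = z then (if p = ∅ then (1 : ℂ) else 0) else 0) fun a ha ↦ ?_)).congr fun a ↦ ?_
      · rw [Finset.mem_singleton] at ha; rw [if_neg ha]
      · by_cases ha : a = z
        · subst ha
          rw [if_pos rfl, hzero _ hz, zero_add, heckeThetaW_term_eq p y _ hz]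
        · have : (a : K) + a₀ ≠ 0 := fun h ↦ ha (Subtype.ext (by
            change (a : K) = -a₀; exact eq_neg_of_add_eq_zero_left h))
          rw [if_neg ha, add_zero, hterm _ this]
    rw [heckeThetaW, hsum.tsum_eq_add_tsum_ite z, heckeThetaConst, heckeThetaW_term_eq p y _ hz,
      (hsC1.sub hsC2).tsum_eq_add_tsum_ite z]
    simp only [ha₀, and_true, hzero _ hz, zero_add, add_sub_cancel_left]
    refine tsum_congr fun a ↦ ?_
    by_cases ha : a = z
    · subst ha; rw [if_pos rfl, if_pos rfl]
    · have : (a : K) + a₀ ≠ 0 := fun h ↦ ha (Subtype.ext (by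
        change (a : K) = -a₀; exact eq_neg_of_add_eq_zero_left h))
      rw [if_neg ha, if_neg ha, hterm _ this]
  · have hne : ∀ a : I, (a : K) + a₀ ≠ 0 := fun a h ↦ ha₀ (by
      have : a₀ = -(a : K) := eq_neg_of_add_eq_zero_right h
      rw [this]; exact hneg a.2)
    rw [heckeThetaConst, if_neg (fun h ↦ ha₀ h.2), sub_zero, heckeThetaW]
    exact tsum_congr fun a ↦ hterm _ (hne a)

/-! ## The stabiliser of the coset and the action of `V = ⟨u_i^N⟩` -/

/-- The units `u` with `(u - 1) a₀ ∈ 𝔞`, i.e. those stabilising the coset `a₀ + 𝔞`, form a subgroup.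
[folklore] -/
def cosetStabilizer (I : FractionalIdeal (𝓞 K)⁰ K) (a₀ : K) : Subgroup (𝓞 K)ˣ where
  carrier := {u | ((u : K) - 1) * a₀ ∈ I}
  mul_mem' {u v} hu hv := by
    have : (((u * v : (𝓞 K)ˣ) : K) - 1) * a₀ = (u : K) * (((v : K) - 1) * a₀) + ((u : K) - 1) * a₀ := by
      push_cast; ring
    rw [Set.mem_setOf_eq, this]
    exact I.val.add_mem (unit_mul_mem u hv) hu
  one_mem' := by simp [FractionalIdeal.zero_mem]
  inv_mem' {u} hu := by
    have : (((u⁻¹ : (𝓞 K)ˣ) : K) - 1) * a₀ = -(((u⁻¹ : (𝓞 K)ˣ) : K) * (((u : K) - 1) * a₀)) := by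
      have h1 : ((u⁻¹ : (𝓞 K)ˣ) : K) * (u : K) = 1 := by
        rw [← coe_mul, inv_mul_cancel, coe_one]
      linear_combination a₀ * h1
    rw [Set.mem_setOf_eq, this]
    exact FractionalIdeal.mem_coe.mp (Submodule.neg_mem _ (FractionalIdeal.mem_coe.mpr (unit_mul_mem _ hu)))

omit [NumberField K] in
/-- Membership in the coset stabiliser. [folklore] -/
theorem mem_cosetStabilizer {I : FractionalIdeal (𝓞 K)⁰ K} {a₀ : K} {u : (𝓞 K)ˣ} :
    u ∈ cosetStabilizer I a₀ ↔ ((u : K) - 1) * a₀ ∈ I := Iff.rfl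

omit [NumberField K] in
/-- A stabilising unit maps the coset to itself: `u(x) ∈ a₀ + 𝔞` for `x ∈ a₀ + 𝔞`. [folklore] -/
theorem unit_mul_sub_mem {I : FractionalIdeal (𝓞 K)⁰ K} {a₀ : K} {u : (𝓞 K)ˣ} (hu : u ∈ cosetStabilizer I a₀)
    {x : K} (hx : x - a₀ ∈ I) : (u : K) * x - a₀ ∈ I := by
  have : (u : K) * x - a₀ = (u : K) * (x - a₀) + ((u : K) - 1) * a₀ := by ring
  rw [this]
  exact I.val.add_mem (unit_mul_mem u hx) hu

/-- Under `(u_i^N - 1) a₀ ∈ 𝔞` for all `i`, every unit `u_{N q} = ∏ u_i^{N q_i}` stabilises the coset.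
[folklore] -/
theorem fundUnit_nsmul_mem_cosetStabilizer {I : FractionalIdeal (𝓞 K)⁰ K} {a₀ : K} {N : ℕ}
    (hV : ∀ i, (((fundSystem K i : (𝓞 K)ˣ) : K) ^ N - 1) * a₀ ∈ I) (q : Fin (rank K) → ℤ) :
    fundUnit K (N • q) ∈ cosetStabilizer I a₀ := by
  rw [fundUnit]
  refine Subgroup.prod_mem _ fun i _ ↦ ?_
  rw [Pi.smul_apply, nsmul_eq_mul, zpow_mul, zpow_natCast]
  refine Subgroup.zpow_mem _ ?_ _
  rw [mem_cosetStabilizer]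
  push_cast
  exact hV i

/-- For even `N`, `u_{Nq}` is the square of `u_{(N/2)q}`. [folklore] -/
theorem fundUnit_nsmul_eq_sq {N : ℕ} (hN : Even N) (q : Fin (rank K) → ℤ) :
    (fundUnit K (N • q) : K) = (fundUnit K ((N / 2) • q) : K) ^ 2 := by
  obtain ⟨k, rfl⟩ := hN
  have hk : (k + k) / 2 = k := by omega
  rw [hk, show (k + k) • q = (k • q) + (k • q) by rw [add_nsmul], fundUnit_add, coe_mul, sq]

/-- **The sign pieces are `V`-stable**: for even `N`, `sgn N((u_{Nq} x)^p) = sgn N(x^p)`. [folklore] -/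
theorem signPiece_fundUnit_nsmul_mul_iff (p : Finset {w : InfinitePlace K // IsReal w}) (ς : SignType) {N : ℕ}
    (hN : Even N) (q : Fin (rank K) → ℤ) (x : K) :
    SignPiece K p ς ((fundUnit K (N • q) : K) * x) ↔ SignPiece K p ς x := by
  have hu : (fundUnit K ((N / 2) • q) : K) ≠ 0 := Units.coe_ne_zero _
  rw [SignPiece, SignPiece, fundUnit_nsmul_eq_sq hN, sign_realPow_sq_mul p hu,
    mul_ne_zero_iff, and_iff_right (pow_ne_zero 2 hu)]

/-! ## Cone exponents and the representatives modulo `V` -/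

/-- The cone exponent, extended by `0` to `x = 0`. [folklore] -/
def coneExp (x : K) : Fin (rank K) → ℤ :=
  if hx : x ≠ 0 then coneExponent x hx else 0

/-- `coneExp` agrees with `coneExponent` off `0`. [folklore] -/
theorem coneExp_of_ne_zero {x : K} (hx : x ≠ 0) : coneExp x = coneExponent x hx := dif_pos hx

/-- **The cone exponent of a unit multiple**: `m(u_e x) = m(x) - e`. [folklore] -/
theorem coneExp_fundUnit_mul (e : Fin (rank K) → ℤ) {x : K} (hx : x ≠ 0) :
    coneExp ((fundUnit K e : K) * x) = coneExp x - e := by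
  have hux : (fundUnit K e : K) * x ≠ 0 := mul_ne_zero (Units.coe_ne_zero _) hx
  rw [coneExp_of_ne_zero hux, coneExp_of_ne_zero hx]
  refine coneExponent_eq hux ?_
  have : (fundUnit K (coneExponent x hx - e) : K) * ((fundUnit K e : K) * x) =
      (fundUnit K (coneExponent x hx) : K) * x := by
    rw [← mul_assoc, ← coe_mul, ← fundUnit_add, sub_add_cancel]
  rw [this]
  exact coneExponent_spec x hx

variable (K)

/-- **The representatives modulo `V`** of the sign piece `ς` of the coset `a₀ + 𝔞`: its elements whose
cone exponent lies in the box `[0, N)^{r-1}` (Neukirch's system of representatives `ℜ` of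
`(𝔎 ∩ 𝒪)/𝒪^*` in the proof of VII (8.3), here modulo the subgroup `V = ⟨u_i^N⟩`). [cite: NeukirchANT1999, Ch. VII §8 proof of (8.3)] -/
def pieceReps (p : Finset {w : InfinitePlace K // IsReal w}) (ς : SignType) (I : FractionalIdeal (𝓞 K)⁰ K)
    (a₀ : K) (N : ℕ) : Set K :=
  {x | x - a₀ ∈ I ∧ SignPiece K p ς x ∧ ∀ i, coneExp x i ∈ Set.Ico (0 : ℤ) N}

/-- The sign piece `ς` of the coset as a subtype of `K`. [folklore] -/
def CosetPiece (p : Finset {w : InfinitePlace K // IsReal w}) (ς : SignType) (I : FractionalIdeal (𝓞 K)⁰ K)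
    (a₀ : K) : Set K :=
  {x | x - a₀ ∈ I ∧ SignPiece K p ς x}

variable {K}

/-- Representatives are nonzero. [folklore] -/
theorem ne_zero_of_mem_pieceReps {p : Finset {w : InfinitePlace K // IsReal w}} {ς : SignType}
    {I : FractionalIdeal (𝓞 K)⁰ K} {a₀ : K} {N : ℕ} {x : K} (hx : x ∈ pieceReps K p ς I a₀ N) : x ≠ 0 :=
  hx.2.1.1

/-- The representative `u_{N⌊m(x)/N⌋} x` has cone exponent `m(x) mod N ∈ [0, N)`. [folklore] -/
theorem coneExp_rep_mem_Ico {N : ℕ} (hN0 : N ≠ 0) {x : K} (hx : x ≠ 0) (i : Fin (rank K)) :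
    coneExp ((fundUnit K (N • fun i ↦ coneExp x i / (N : ℤ)) : K) * x) i ∈ Set.Ico (0 : ℤ) N := by
  rw [coneExp_fundUnit_mul _ hx, Pi.sub_apply, Pi.smul_apply, nsmul_eq_mul]
  have hNpos : (0 : ℤ) < N := by exact_mod_cast Nat.pos_of_ne_zero hN0
  have h1 := Int.emod_nonneg (coneExp x i) hNpos.ne'
  have h2 := Int.emod_lt_of_pos (coneExp x i) hNpos
  have h3 := Int.emod_add_mul_ediv (coneExp x i) N
  constructor <;> linarith

/-- The quotient `m(u_{Nq} x₁)/N = -q` for a representative `x₁` (cone exponent in the box). [folklore] -/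
theorem coneExp_fundUnit_nsmul_mul_ediv {N : ℕ} (hN0 : N ≠ 0) {x₁ : K} (hx₁ : x₁ ≠ 0)
    (hbox : ∀ i, coneExp x₁ i ∈ Set.Ico (0 : ℤ) N) (q : Fin (rank K) → ℤ) (i : Fin (rank K)) :
    coneExp ((fundUnit K (N • q) : K) * x₁) i / (N : ℤ) = -q i := by
  rw [coneExp_fundUnit_mul _ hx₁, Pi.sub_apply, Pi.smul_apply, nsmul_eq_mul]
  have h0 : coneExp x₁ i / (N : ℤ) = 0 := Int.ediv_eq_zero_of_lt (hbox i).1 (hbox i).2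
  have hN' : (N : ℤ) ≠ 0 := by exact_mod_cast hN0
  rw [show coneExp x₁ i - (N : ℤ) * q i = coneExp x₁ i + (N : ℤ) * (-q i) by ring,
    Int.add_mul_ediv_left _ _ hN', h0, zero_add]

/-- **Decomposition of the sign piece along `V`** (the bijection `ℜ × V ≅ 𝔎̂ ∩ 𝒪̂` behind
`∫_S Σ_{ℜ} = Σ_ε ∫_{ε²F}` in the proof of Neukirch VII (8.3)): for even `N ≠ 0` with `(u_i^N - 1)a₀ ∈ 𝔞`,
`(x₁, q) ↦ u_{Nq} x₁` is a bijection from `pieceReps × ℤ^{r-1}` onto the sign piece of the coset.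
[cite: NeukirchANT1999, Ch. VII §8 proof of (8.3)] -/
def pieceEquiv (p : Finset {w : InfinitePlace K // IsReal w}) (ς : SignType) (I : FractionalIdeal (𝓞 K)⁰ K)
    (a₀ : K) {N : ℕ} (hN0 : N ≠ 0) (hN : Even N)
    (hV : ∀ i, (((fundSystem K i : (𝓞 K)ˣ) : K) ^ N - 1) * a₀ ∈ I) :
    pieceReps K p ς I a₀ N × (Fin (rank K) → ℤ) ≃ CosetPiece K p ς I a₀ where
  toFun z := ⟨(fundUnit K (N • z.2) : K) * (z.1 : K),
    unit_mul_sub_mem (fundUnit_nsmul_mem_cosetStabilizer hV z.2) z.1.2.1,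
    (signPiece_fundUnit_nsmul_mul_iff p ς hN z.2 _).mpr z.1.2.2.1⟩
  invFun x := ⟨⟨(fundUnit K (N • fun i ↦ coneExp (x : K) i / (N : ℤ)) : K) * (x : K),
      unit_mul_sub_mem (fundUnit_nsmul_mem_cosetStabilizer hV _) x.2.1,
      (signPiece_fundUnit_nsmul_mul_iff p ς hN _ _).mpr x.2.2,
      fun i ↦ coneExp_rep_mem_Ico hN0 x.2.2.1 i⟩,
      fun i ↦ -(coneExp (x : K) i / (N : ℤ))⟩
  left_inv z := by
    obtain ⟨⟨x₁, hx₁⟩, q⟩ := z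
    have hq : ∀ i, coneExp ((fundUnit K (N • q) : K) * x₁) i / (N : ℤ) = -q i :=
      coneExp_fundUnit_nsmul_mul_ediv hN0 hx₁.2.1.1 hx₁.2.2 q
    refine Prod.ext (Subtype.ext ?_) (funext fun i ↦ by
      show -(coneExp ((fundUnit K (N • q) : K) * x₁) i / (N : ℤ)) = q i
      rw [hq i, neg_neg])
    change (fundUnit K (N • fun i ↦ coneExp ((fundUnit K (N • q) : K) * x₁) i / (N : ℤ)) : K) *
      ((fundUnit K (N • q) : K) * x₁) = x₁
    have : (N • fun i ↦ coneExp ((fundUnit K (N • q) : K) * x₁) i / (N : ℤ)) = -(N • q) := by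
      funext i
      rw [Pi.smul_apply, Pi.neg_apply, Pi.smul_apply, hq i, smul_neg]
    rw [this, fundUnit_neg_mul_fundUnit_mul]
  right_inv x := by
    refine Subtype.ext ?_
    change (fundUnit K (N • fun i ↦ -(coneExp (x : K) i / (N : ℤ))) : K) *
      ((fundUnit K (N • fun i ↦ coneExp (x : K) i / (N : ℤ)) : K) * (x : K)) = x
    have : (N • fun i ↦ -(coneExp (x : K) i / (N : ℤ))) = -(N • fun i ↦ coneExp (x : K) i / (N : ℤ)) := by
      funext i
      rw [Pi.smul_apply, Pi.neg_apply, Pi.smul_apply, smul_neg]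
    rw [this, fundUnit_neg_mul_fundUnit_mul]

/-- `pieceEquiv` on points. [folklore] -/
theorem pieceEquiv_apply (p : Finset {w : InfinitePlace K // IsReal w}) (ς : SignType) (I : FractionalIdeal (𝓞 K)⁰ K)
    (a₀ : K) {N : ℕ} (hN0 : N ≠ 0) (hN : Even N)
    (hV : ∀ i, (((fundSystem K i : (𝓞 K)ˣ) : K) ^ N - 1) * a₀ ∈ I) (z : pieceReps K p ς I a₀ N × (Fin (rank K) → ℤ)) :
    ((pieceEquiv p ς I a₀ hN0 hN hV z : CosetPiece K p ς I a₀) : K) = (fundUnit K (N • z.2) : K) * (z.1 : K) := rfl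

/-! ## Moving the unit onto the coordinates, tiling, and the cube integral of a piece -/

/-- **The weighted summand at `u_m x` is the summand at `x` in the coordinates `c + m`**:
`W_p(y(c,t), u_m x) = W_p(y(c+m,t), x)` (`|u_m|_τ² y(c,t)_τ = y(c+m,t)_τ`). [folklore] -/
theorem weightedThetaSummand_fundUnit_mul (p : Finset {w : InfinitePlace K // IsReal w})
    (m : Fin (rank K) → ℤ) (x : K) (c : Fin (rank K) → ℝ) (t : ℝ) :
    weightedThetaSummand K p (heckeCoord K c t) ((fundUnit K m : K) * x) =
      weightedThetaSummand K p (heckeCoord K (c + fun i ↦ (m i : ℝ)) t) x := by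
  rw [weightedThetaSummand_eq, weightedThetaSummand_eq, thetaSummand_fundUnit_mul]
  congr 1
  rw [← Finset.prod_mul_distrib, ← Finset.prod_mul_distrib]
  refine Finset.prod_congr rfl fun w _ ↦ ?_
  rw [heckeCoord_add_intCast, map_mul, Real.sqrt_mul (sq_nonneg _), Real.sqrt_sq (apply_nonneg _ _), fundUnit]
  ring

/-- **Scaling in `ℝ^ι`**: `∫ G(βc) dc = |β|^{-|ι|} ∫ G(c) dc` for `β ≠ 0` (Lebesgue measure, `ℝ≥0∞`-valued;
Mathlib `Measure.map_addHaar_smul`). [folklore] -/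
theorem lintegral_comp_smul' {ι : Type*} [Fintype ι] {β : ℝ} (hβ : β ≠ 0) (G : (ι → ℝ) → ℝ≥0∞) :
    ∫⁻ c : ι → ℝ, G (β • c) = ENNReal.ofReal ((|β| ^ Fintype.card ι)⁻¹) * ∫⁻ c, G c := by
  let e : (ι → ℝ) ≃ᵐ (ι → ℝ) := (Homeomorph.smul (isUnit_iff_ne_zero.2 hβ).unit).toMeasurableEquiv
  have he : ∀ c, e c = β • c := fun _ ↦ rfl
  calc ∫⁻ c : ι → ℝ, G (β • c) = ∫⁻ c, G (e c) := by simp_rw [he]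
    _ = ∫⁻ c, G c ∂(Measure.map e volume) := (lintegral_map_equiv G e).symm
    _ = ∫⁻ c, G c ∂(Measure.map (fun c : ι → ℝ ↦ β • c) volume) := rfl
    _ = ENNReal.ofReal ((|β| ^ Fintype.card ι)⁻¹) * ∫⁻ c, G c := by
        rw [Measure.map_addHaar_smul volume hβ, lintegral_smul_measure, Module.finrank_fintype_fun_eq_card,
          abs_inv, abs_pow]
        rfl

/-- A fractional-ideal coset piece is countable. [folklore] -/
theorem countable_cosetPiece (p : Finset {w : InfinitePlace K // IsReal w}) (ς : SignType) (I : FractionalIdeal (𝓞 K)⁰ K)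
    (a₀ : K) : Countable (CosetPiece K p ς I a₀) := by
  haveI := countable_fractionalIdeal I
  refine (Function.Injective.countable (f := fun x : CosetPiece K p ς I a₀ ↦ (⟨(x : K) - a₀, x.2.1⟩ : I)) ?_)
  intro x x' h
  have := congrArg (fun z : I ↦ (z : K)) h
  exact Subtype.ext (sub_left_injective this)

/-- The representatives form a countable set. [folklore] -/
theorem countable_pieceReps (p : Finset {w : InfinitePlace K // IsReal w}) (ς : SignType) (I : FractionalIdeal (𝓞 K)⁰ K)
    (a₀ : K) (N : ℕ) : Countable (pieceReps K p ς I a₀ N) := by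
  have h : pieceReps K p ς I a₀ N ⊆ CosetPiece K p ς I a₀ := fun x hx ↦ ⟨hx.1, hx.2.1⟩
  exact (Set.Countable.mono h (Set.countable_coe_iff.mp (countable_cosetPiece p ς I a₀))).to_subtype

/-- **The sign piece as a sum over the coset piece**: `pieceTheta(y) = Σ_{x ∈ CosetPiece} W_p(y, x)`
(re-indexing `a ↦ a + a₀`, dropping the vanishing terms). [folklore] -/
theorem pieceTheta_eq_tsum_cosetPiece (p : Finset {w : InfinitePlace K // IsReal w}) (ς : SignType)
    (I : FractionalIdeal (𝓞 K)⁰ K) (a₀ : K) (y : InfinitePlace K → ℝ) :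
    pieceTheta K p ς I a₀ y = ∑' x : CosetPiece K p ς I a₀, weightedThetaSummand K p y (x : K) := by
  rw [pieceTheta]
  have hsupp : Function.support (fun a : I ↦
      if SignPiece K p ς ((a : K) + a₀) then weightedThetaSummand K p y ((a : K) + a₀) else 0) ⊆
      {a : I | SignPiece K p ς ((a : K) + a₀)} := by
    intro a ha
    by_contra h
    exact ha (if_neg h)
  rw [← tsum_subtype_eq_of_support_subset hsupp]
  let e : ({a : I | SignPiece K p ς ((a : K) + a₀)} : Set I) ≃ CosetPiece K p ς I a₀ :=
    { toFun := fun a ↦ ⟨((a : I) : K) + a₀, by rw [add_sub_cancel_right]; exact (a : I).2, a.2⟩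
      invFun := fun x ↦ ⟨⟨(x : K) - a₀, x.2.1⟩, by
        change SignPiece K p ς (((x : K) - a₀) + a₀); rw [sub_add_cancel]; exact x.2.2⟩
      left_inv := fun a ↦ by ext; simp
      right_inv := fun x ↦ by ext; simp }
  rw [← e.symm.tsum_eq]
  refine tsum_congr fun x ↦ ?_
  have hx : SignPiece K p ς ((((e.symm x : ({a : I | SignPiece K p ς ((a : K) + a₀)} : Set I)) : I) : K) + a₀) :=
    (e.symm x).2
  rw [if_pos hx]
  congr 1
  change ((x : K) - a₀) + a₀ = (x : K)
  ring

/-- Measurability of the weighted summand in Hecke's scaled coordinates (as a function of `c`). [folklore] -/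
theorem measurable_weightedThetaSummand_heckeCoord_smul (p : Finset {w : InfinitePlace K // IsReal w})
    (x : K) (β t : ℝ) :
    Measurable fun c : Fin (rank K) → ℝ ↦ weightedThetaSummand K p (heckeCoord K (β • c) t) x := by
  have hc : Continuous fun y : InfinitePlace K → ℝ ↦ weightedThetaSummand K p y x := by
    unfold weightedThetaSummand
    exact (continuous_finsetProd _ fun w _ ↦ continuous_const.mul
      (Real.continuous_sqrt.comp (continuous_apply _))).mul (continuous_thetaSummand x)
  exact (hc.comp (continuous_heckeCoord_smul β t)).measurable

/-- **Unfolding the cube integral of a sign piece over `V`**: for even `N ≠ 0` with `(u_i^N - 1)a₀ ∈ 𝔞`,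
`∫_{[0,1]^{r-1}} pieceTheta(y(Nc, t)) dc = Σ_{x ∈ pieceReps} ∫_{ℝ^{r-1}} W_p(y(Nc, t), x) dc`
(`ℝ≥0∞`-valued): re-index along `pieceEquiv`, move `u_{Nq}` onto the coordinates
(`y(N(c+q), t)`), and tile `ℝ^{r-1}` by the translates of the unit cube.  This is
`∫_F Σ_ε g(|ε|²x) = ∫_S g` of the proof of Neukirch VII (8.3). [cite: NeukirchANT1999, Ch. VII §8 proof of (8.3)] -/
theorem lintegral_unitCube_pieceTheta (p : Finset {w : InfinitePlace K // IsReal w}) (ς : SignType)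
    (I : FractionalIdeal (𝓞 K)⁰ K) (a₀ : K) {N : ℕ} (hN0 : N ≠ 0) (hN : Even N)
    (hV : ∀ i, (((fundSystem K i : (𝓞 K)ˣ) : K) ^ N - 1) * a₀ ∈ I) (t : ℝ) :
    ∫⁻ c in Set.Icc (0 : Fin (rank K) → ℝ) 1, ENNReal.ofReal (pieceTheta K p ς I a₀ (heckeCoord K ((N : ℝ) • c) t)) =
      ∑' x : pieceReps K p ς I a₀ N, ∫⁻ c : Fin (rank K) → ℝ,
        ENNReal.ofReal (weightedThetaSummand K p (heckeCoord K ((N : ℝ) • c) t) (x : K)) := by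
  haveI := countable_cosetPiece p ς I a₀
  haveI := countable_pieceReps p ς I a₀ N
  set e := pieceEquiv p ς I a₀ hN0 hN hV with he
  -- the piece as an `ℝ≥0∞`-valued sum over `pieceReps × ℤ^{r-1}`, with the unit on the coordinates
  have hsum : ∀ y : InfinitePlace K → ℝ, (∀ w, 0 < y w) →
      Summable fun x : CosetPiece K p ς I a₀ ↦ weightedThetaSummand K p y (x : K) := by
    intro y hy
    have h := summable_pieceTheta p ς I a₀ hy
    have hs : Summable fun a : ({a : I | SignPiece K p ς ((a : K) + a₀)} : Set I) ↦
        weightedThetaSummand K p y (((a : I) : K) + a₀) := by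
      refine (h.subtype {a : I | SignPiece K p ς ((a : K) + a₀)}).congr fun a ↦ ?_
      simp only [Function.comp_apply]
      rw [if_pos (show SignPiece K p ς (((a : I) : K) + a₀) from a.2)]
    let e' : ({a : I | SignPiece K p ς ((a : K) + a₀)} : Set I) ≃ CosetPiece K p ς I a₀ :=
      { toFun := fun a ↦ ⟨((a : I) : K) + a₀, by rw [add_sub_cancel_right]; exact (a : I).2, a.2⟩
        invFun := fun x ↦ ⟨⟨(x : K) - a₀, x.2.1⟩, by
          change SignPiece K p ς (((x : K) - a₀) + a₀); rw [sub_add_cancel]; exact x.2.2⟩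
        left_inv := fun a ↦ by ext; simp
        right_inv := fun x ↦ by ext; simp }
    exact (e'.summable_iff (f := fun x : CosetPiece K p ς I a₀ ↦ weightedThetaSummand K p y (x : K))).mp
      (hs.congr fun a ↦ rfl)
  have h1 : ∀ c : Fin (rank K) → ℝ, ENNReal.ofReal (pieceTheta K p ς I a₀ (heckeCoord K ((N : ℝ) • c) t)) =
      ∑' z : pieceReps K p ς I a₀ N × (Fin (rank K) → ℤ),
        ENNReal.ofReal (weightedThetaSummand K p
          (heckeCoord K ((N : ℝ) • (c + fun i ↦ (z.2 i : ℝ))) t) (z.1 : K)) := by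
    intro c
    rw [pieceTheta_eq_tsum_cosetPiece, ENNReal.ofReal_tsum_of_nonneg (fun _ ↦ weightedThetaSummand_nonneg _ _ _)
      (hsum _ (heckeCoord_pos _ t)), ← e.tsum_eq]
    refine tsum_congr fun z ↦ ?_
    rw [he, pieceEquiv_apply, weightedThetaSummand_fundUnit_mul]
    congr 3
    funext i
    simp only [Pi.add_apply, Pi.smul_apply, smul_eq_mul, nsmul_eq_mul]
    push_cast
    ring
  have hmeas : ∀ z : pieceReps K p ς I a₀ N × (Fin (rank K) → ℤ), AEMeasurable (fun c : Fin (rank K) → ℝ ↦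
      ENNReal.ofReal (weightedThetaSummand K p (heckeCoord K ((N : ℝ) • (c + fun i ↦ (z.2 i : ℝ))) t) (z.1 : K)))
      (volume.restrict (Set.Icc (0 : Fin (rank K) → ℝ) 1)) := fun z ↦
    ((measurable_weightedThetaSummand_heckeCoord_smul (K := K) p (z.1 : K) N t).comp
      (measurable_id.add_const _)).ennreal_ofReal.aemeasurable
  simp_rw [h1]
  rw [lintegral_tsum hmeas, ENNReal.tsum_prod']
  refine tsum_congr fun x ↦ ?_
  rw [lintegral_eq_tsum_lintegral_unitCube_add_intCast]

/-! ## The Mellin transform of a piece at real `σ > 0`, unfolded -/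

/-- Joint measurability of `(t, c) ↦ W_p(y(βc, t), x)`. [folklore] -/
theorem measurable_weightedThetaSummand_heckeCoord_uncurry (p : Finset {w : InfinitePlace K // IsReal w}) (x : K)
    (β : ℝ) : Measurable fun z : ℝ × (Fin (rank K) → ℝ) ↦ weightedThetaSummand K p (heckeCoord K (β • z.2) z.1) x := by
  unfold weightedThetaSummand thetaSummand minkowskiQuadForm heckeCoord heckeLogCoord
  fun_prop

/-- **The Mellin transform of a sign piece at real `σ > 0`, unfolded over its representatives** (Neukirch
VII, proof of (8.3) with the Gamma integrals evaluated): for even `N ≠ 0` with `(u_i^N - 1)a₀ ∈ 𝔞`,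
`∫_{t>0} t^{σ-1} ∫_{[0,1]^{r-1}} pieceTheta(y(Nc,t)) dc dt
   = Σ_{x ∈ pieceReps} N^{-(r-1)} 2^{-(r-1)} n (2^{-r₂} n R)⁻¹ A_p(σ) |N_{K/ℚ}(x)|^{-2σ}`
(`ℝ≥0∞`-valued; both sides may be `∞` for `σ ≤ 1/2`). [cite: NeukirchANT1999, Ch. VII §8 proof of (8.3)] -/
theorem lintegral_Ioi_rpow_mul_lintegral_unitCube_pieceTheta (p : Finset {w : InfinitePlace K // IsReal w})
    (ς : SignType) (I : FractionalIdeal (𝓞 K)⁰ K) (a₀ : K) {N : ℕ} (hN0 : N ≠ 0) (hN : Even N)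
    (hV : ∀ i, (((fundSystem K i : (𝓞 K)ˣ) : K) ^ N - 1) * a₀ ∈ I) {σ : ℝ} (hσ : 0 < σ) :
    ∫⁻ t in Set.Ioi 0, ENNReal.ofReal (t ^ (σ - 1)) *
        ∫⁻ c in Set.Icc (0 : Fin (rank K) → ℝ) 1, ENNReal.ofReal (pieceTheta K p ς I a₀ (heckeCoord K ((N : ℝ) • c) t)) =
      ∑' x : pieceReps K p ς I a₀ N, ENNReal.ofReal (((N : ℝ) ^ rank K)⁻¹ *
        ((2 ^ rank K)⁻¹ * Module.finrank ℚ K * (2⁻¹ ^ nrComplexPlaces K * Module.finrank ℚ K * regulator K)⁻¹) *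
        (∏ w : InfinitePlace K, (1 / (Real.pi * mult w)) ^ ((mult w : ℝ) * σ + halfWeight K p w) *
          Real.Gamma ((mult w : ℝ) * σ + halfWeight K p w)) *
        (|(Algebra.norm ℚ (x : K) : ℚ)| : ℝ) ^ (-2 * σ)) := by
  haveI := countable_pieceReps p ς I a₀ N
  simp_rw [lintegral_unitCube_pieceTheta p ς I a₀ hN0 hN hV]
  have hNr : ((N : ℝ)) ≠ 0 := by exact_mod_cast hN0
  -- rescale `c ↦ Nc`
  have hscale : ∀ (x : K) (t : ℝ), ∫⁻ c : Fin (rank K) → ℝ,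
      ENNReal.ofReal (weightedThetaSummand K p (heckeCoord K ((N : ℝ) • c) t) x) =
      ENNReal.ofReal (((N : ℝ) ^ rank K)⁻¹) *
        ∫⁻ c : Fin (rank K) → ℝ, ENNReal.ofReal (weightedThetaSummand K p (heckeCoord K c t) x) := by
    intro x t
    have := lintegral_comp_smul' (ι := Fin (rank K)) hNr
      (fun c ↦ ENNReal.ofReal (weightedThetaSummand K p (heckeCoord K c t) x))
    simp only [Fintype.card_fin, Nat.abs_cast] at this
    exact this
  simp_rw [hscale]
  have hmeas : ∀ x : pieceReps K p ς I a₀ N, AEMeasurable (fun t : ℝ ↦ ENNReal.ofReal (t ^ (σ - 1)) *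
      (ENNReal.ofReal (((N : ℝ) ^ rank K)⁻¹) *
        ∫⁻ c : Fin (rank K) → ℝ, ENNReal.ofReal (weightedThetaSummand K p (heckeCoord K c t) (x : K))))
      (volume.restrict (Set.Ioi 0)) := fun x ↦ by
    refine ((measurable_id.pow_const _).ennreal_ofReal.mul (Measurable.const_mul ?_ _)).aemeasurable
    have := (measurable_weightedThetaSummand_heckeCoord_uncurry (K := K) p (x : K) 1).ennreal_ofReal
    simp only [one_smul] at this
    exact this.lintegral_prod_right'
  calc ∫⁻ t in Set.Ioi 0, ENNReal.ofReal (t ^ (σ - 1)) *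
        ∑' x : pieceReps K p ς I a₀ N, ENNReal.ofReal (((N : ℝ) ^ rank K)⁻¹) *
          ∫⁻ c : Fin (rank K) → ℝ, ENNReal.ofReal (weightedThetaSummand K p (heckeCoord K c t) (x : K))
      = ∫⁻ t in Set.Ioi 0, ∑' x : pieceReps K p ς I a₀ N, ENNReal.ofReal (t ^ (σ - 1)) *
          (ENNReal.ofReal (((N : ℝ) ^ rank K)⁻¹) *
          ∫⁻ c : Fin (rank K) → ℝ, ENNReal.ofReal (weightedThetaSummand K p (heckeCoord K c t) (x : K))) := by
        simp_rw [ENNReal.tsum_mul_left]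
    _ = ∑' x : pieceReps K p ς I a₀ N, ∫⁻ t in Set.Ioi 0, ENNReal.ofReal (t ^ (σ - 1)) *
          (ENNReal.ofReal (((N : ℝ) ^ rank K)⁻¹) *
          ∫⁻ c : Fin (rank K) → ℝ, ENNReal.ofReal (weightedThetaSummand K p (heckeCoord K c t) (x : K))) :=
        lintegral_tsum hmeas
    _ = ∑' x : pieceReps K p ς I a₀ N, ENNReal.ofReal (((N : ℝ) ^ rank K)⁻¹) *
          ∫⁻ t in Set.Ioi 0, ENNReal.ofReal (t ^ (σ - 1)) *
            ∫⁻ c : Fin (rank K) → ℝ, ENNReal.ofReal (weightedThetaSummand K p (heckeCoord K c t) (x : K)) := by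
        refine tsum_congr fun x ↦ ?_
        rw [← lintegral_const_mul' _ _ ENNReal.ofReal_ne_top]
        exact lintegral_congr fun t ↦ by ring
    _ = _ := tsum_congr fun x ↦ by
        rw [lintegral_Ioi_rpow_mul_lintegral_weightedThetaSummand_heckeCoord p (x : K)
          (ne_zero_of_mem_pieceReps x.2) hσ, prod_weightedGammaFactor_eq_mul_norm_rpow p (x : K)
          (ne_zero_of_mem_pieceReps x.2) σ, ← ENNReal.ofReal_mul (inv_nonneg.mpr (pow_nonneg (Nat.cast_nonneg _) _))]
        congr 1
        ring

end NumberField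

end Literature.NumberTheory.LFunctions
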